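import Mathlib
import Literature.Probability.Moments.CoordinateAveraging
import HarnessLib

/-!
# The Efron–Stein / Hoeffding orthogonal decomposition and the degree bound on total influence

Topic `Literature/Probability/Moments` (counting form, finite product space `ι → Γ`, uniform
measure). Building on the averaging operators `coordAvg S` (`E_S`) of `CoordinateAveraging.lean`:

* `hoeffdingComp S F` — the Hoeffding (orthogonal / ANOVA / Efron–Stein) component `F^{=S}` of
  `F : (ι → Γ) → ℝ`, defined by inclusion–exclusion
  `F^{=S} := Σ_{R ⊆ S} (−1)^{|S∖R|} E_{Rᶜ} F` (O'Donnell 2014, §8.3, Def. 8.33 / Prop. 8.36);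
* the decomposition `Σ_{S ⊆ V} F^{=S} = E_{Vᶜ} F` (so `Σ_S F^{=S} = F`, Thm. 8.35), the projection
  formula `F − E_{i} F = Σ_{S ∋ i} F^{=S}`, `E_{i} F^{=S} = 0` for `i ∈ S`, ORTHOGONALITY of distinct
  components and Pythagoras;
* juntas: `F^{=S} = 0` unless `S ⊆ T` when `F` depends only on the coordinates in `T`; hence a sum of
  `D`-juntas has no component above level `D`;
* **the degree bound on total influence** (O'Donnell 2014 §8.3–8.4, `I[f] = Σ_S |S| ‖f^{=S}‖² ≤
  deg(f) · Var f`): for a finite sum `F` of functions each depending on at most `D` coordinates,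
  `Σ_i Σ_y (F y − E_{i} F y)² ≤ D · Σ_y F y²`, and in resampling form
  `Σ_i Σ_y Σ_ℓ (F y − F (y[i ↦ ℓ]))² ≤ 2 D |Γ| · Σ_y F y²`.

Everything is proved (no named facts). The hypothesis "finite sum of `D`-juntas" is spelled out
(`∃ 𝒮 G, (∀ T ∈ 𝒮, #T ≤ D ∧ DependsOn (G T) T) ∧ ∀ y, F y = Σ_{T ∈ 𝒮} G T y`); it is literally the
body of `Literature.Computability.Complexity.IsCoordDegreeLE D F` (coordinate / Efron–Stein degree),
which therefore applies by `obtain`.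

References: R. O'Donnell, *Analysis of Boolean Functions*, CUP 2014, §8.3 (Def. 8.33, Thm. 8.35,
Prop. 8.36, Prop. 8.45) [ODonnell2014]; B. Efron, C. Stein, *The jackknife estimate of variance*,
Ann. Statist. 9 (1981) [EfronStein1981].
-/

noncomputable section

namespace Literature.Probability.Moments

open Finset

variable {ι Γ : Type*} [Fintype ι] [DecidableEq ι] [Fintype Γ]

/-- **Hoeffding component** `F^{=S}` (O'Donnell 2014, §8.3), by inclusion–exclusion over the
"depends only on `R`" projections `F^{⊆R} = E_{Rᶜ} F`:
`F^{=S} y := Σ_{R ⊆ S} (−1)^{|S∖R|} · E_{Rᶜ} F y`. [cite: ODonnell2014, §8.3 Def. 8.33] -/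
def hoeffdingComp (S : Finset ι) (F : (ι → Γ) → ℝ) (y : ι → Γ) : ℝ :=
  ∑ R ∈ S.powerset, (-1 : ℝ) ^ (S \ R).card * coordAvg Rᶜ F y

/-- Unfolding of `hoeffdingComp`. [folklore] -/
theorem hoeffdingComp_apply (S : Finset ι) (F : (ι → Γ) → ℝ) (y : ι → Γ) :
    hoeffdingComp S F y = ∑ R ∈ S.powerset, (-1 : ℝ) ^ (S \ R).card * coordAvg Rᶜ F y := rfl

/-! ### Linearity -/

/-- `F ↦ F^{=S}` is additive. [folklore] -/
theorem hoeffdingComp_add (S : Finset ι) (F G : (ι → Γ) → ℝ) :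
    hoeffdingComp S (fun y => F y + G y) = fun y => hoeffdingComp S F y + hoeffdingComp S G y := by
  funext y
  simp only [hoeffdingComp, coordAvg_add, mul_add, sum_add_distrib]

/-- `F ↦ F^{=S}` is homogeneous. [folklore] -/
theorem hoeffdingComp_smul (S : Finset ι) (c : ℝ) (F : (ι → Γ) → ℝ) :
    hoeffdingComp S (fun y => c * F y) = fun y => c * hoeffdingComp S F y := by
  funext y
  simp only [hoeffdingComp, coordAvg_smul, mul_sum]
  refine sum_congr rfl fun R _ => by ring

/-- `0^{=S} = 0`. [folklore] -/
theorem hoeffdingComp_zero (S : Finset ι) :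
    hoeffdingComp S (fun _ : ι → Γ => (0 : ℝ)) = fun _ => 0 := by
  funext y; simp [hoeffdingComp, coordAvg_zero]

/-- `F ↦ F^{=S}` commutes with finite sums. [folklore] -/
theorem hoeffdingComp_sum {α : Type*} (S : Finset ι) (s : Finset α) (F : α → (ι → Γ) → ℝ) :
    hoeffdingComp S (fun y => ∑ a ∈ s, F a y) = fun y => ∑ a ∈ s, hoeffdingComp S (F a) y := by
  classical
  induction s using Finset.induction_on with
  | empty => simpa using hoeffdingComp_zero (Γ := Γ) S
  | insert a s ha ih =>
    funext y
    have h := hoeffdingComp_add S (F a) (fun y => ∑ b ∈ s, F b y)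
    simp only [sum_insert ha]
    rw [h]
    simp only [ih]

/-! ### The decomposition (Möbius inversion on the Boolean lattice) -/

/-- Alternating sums over a Boolean interval: `Σ_{R ⊆ S ⊆ V} (−1)^{|S∖R|} = [R = V]` for `R ⊆ V`.
[folklore] -/
theorem sum_neg_one_pow_card_sdiff_Icc {R V : Finset ι} (hRV : R ⊆ V) :
    ∑ S ∈ V.powerset.filter (fun S => R ⊆ S), (-1 : ℝ) ^ (S \ R).card = if R = V then 1 else 0 := by
  -- reindex `S = R ∪ U`, `U ⊆ V \ R`
  have hre : ∑ S ∈ V.powerset.filter (fun S => R ⊆ S), (-1 : ℝ) ^ (S \ R).card =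
      ∑ U ∈ (V \ R).powerset, (-1 : ℝ) ^ U.card := by
    refine Finset.sum_nbij' (fun S => S \ R) (fun U => R ∪ U) ?_ ?_ ?_ ?_ ?_
    · intro S hS
      simp only [mem_filter, mem_powerset] at hS
      exact mem_powerset.2 (sdiff_subset_sdiff hS.1 subset_rfl)
    · intro U hU
      rw [mem_powerset] at hU
      simp only [mem_filter, mem_powerset]
      exact ⟨union_subset hRV (hU.trans sdiff_subset), subset_union_left⟩
    · intro S hS
      simp only [mem_filter, mem_powerset] at hS
      exact union_sdiff_of_subset hS.2
    · intro U hU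
      rw [mem_powerset] at hU
      rw [union_sdiff_left, Finset.sdiff_eq_self_iff_disjoint]
      exact Finset.sdiff_disjoint.mono_left hU
    · intro S _; rfl
  rw [hre]
  have hz := Finset.sum_powerset_neg_one_pow_card (x := V \ R)
  have hcast : ∑ U ∈ (V \ R).powerset, (-1 : ℝ) ^ U.card =
      ((∑ U ∈ (V \ R).powerset, (-1 : ℤ) ^ U.card : ℤ) : ℝ) := by push_cast; rfl
  rw [hcast, hz]
  by_cases h : R = V
  · subst h; simp
  · have hne : V \ R ≠ ∅ := by
      intro he
      exact h (subset_antisymm hRV (sdiff_eq_empty_iff_subset.1 he))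
    simp [h, hne]

/-- **The decomposition over a sub-lattice** (Möbius inversion): for every `V`,
`Σ_{S ⊆ V} F^{=S} = E_{Vᶜ} F` (the part of `F` depending only on the coordinates in `V`).
[cite: ODonnell2014, §8.3 Prop. 8.36] -/
theorem sum_hoeffdingComp_powerset (V : Finset ι) (F : (ι → Γ) → ℝ) (y : ι → Γ) :
    ∑ S ∈ V.powerset, hoeffdingComp S F y = coordAvg Vᶜ F y := by
  simp only [hoeffdingComp]
  -- swap the sums: `Σ_{S ⊆ V} Σ_{R ⊆ S} = Σ_{R ⊆ V} Σ_{S : R ⊆ S ⊆ V}`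
  rw [Finset.sum_sigma', show (V.powerset.sigma fun S => S.powerset) =
      ((V.powerset.sigma fun R => V.powerset.filter fun S => R ⊆ S).map
        ⟨fun p => ⟨p.2, p.1⟩, fun p q h => by
          simp only [Sigma.mk.injEq, heq_eq_eq] at h; ext <;> simp [h.1, h.2]⟩) from ?_,
    Finset.sum_map]
  · simp only [Function.Embedding.coeFn_mk]
    rw [← Finset.sum_sigma' V.powerset (fun R => V.powerset.filter fun S => R ⊆ S)
      (fun R S => (-1 : ℝ) ^ (S \ R).card * coordAvg Rᶜ F y)]
    simp_rw [← sum_mul]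
    rw [← Finset.sum_erase_add _ _ (mem_powerset_self V)]
    rw [sum_neg_one_pow_card_sdiff_Icc subset_rfl, if_pos rfl, one_mul]
    rw [Finset.sum_eq_zero fun R hR => ?_, zero_add]
    have hR' : R ⊆ V := mem_powerset.1 (mem_of_mem_erase hR)
    rw [sum_neg_one_pow_card_sdiff_Icc hR', if_neg (ne_of_mem_erase hR), zero_mul]
  · ext ⟨S, R⟩
    simp only [mem_sigma, mem_powerset, mem_map, mem_filter, Function.Embedding.coeFn_mk,
      Sigma.mk.injEq, Sigma.exists, heq_eq_eq]
    constructor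
    · rintro ⟨hSV, hRS⟩
      exact ⟨R, S, ⟨hRS.trans hSV, hSV, hRS⟩, rfl, rfl⟩
    · rintro ⟨R', S', ⟨_, hS'V, hR'S'⟩, rfl, rfl⟩
      exact ⟨hS'V, hR'S'⟩

/-- **The Hoeffding decomposition**: `Σ_S F^{=S} = F`. [cite: ODonnell2014, §8.3 Thm. 8.35] -/
theorem sum_hoeffdingComp_univ [Nonempty Γ] (F : (ι → Γ) → ℝ) (y : ι → Γ) :
    ∑ S ∈ (univ : Finset ι).powerset, hoeffdingComp S F y = F y := by
  rw [sum_hoeffdingComp_powerset, compl_univ, coordAvg_empty]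

/-- **Projection formula**: `F − E_{i} F = Σ_{S ∋ i} F^{=S}` (O'Donnell 2014, Prop. 8.45:
`L_i f = Σ_{S ∋ i} f^{=S}`). [cite: ODonnell2014, §8.3 Prop. 8.45] -/
theorem sub_coordAvg_singleton_eq_sum [Nonempty Γ] (i : ι) (F : (ι → Γ) → ℝ) (y : ι → Γ) :
    F y - coordAvg {i} F y =
      ∑ S ∈ (univ : Finset ι).powerset.filter (fun S => i ∈ S), hoeffdingComp S F y := by
  have htot := sum_hoeffdingComp_univ F y
  have hoff : ∑ S ∈ (univ.erase i).powerset, hoeffdingComp S F y = coordAvg {i} F y := by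
    rw [sum_hoeffdingComp_powerset]
    congr 1
    ext j; simp
  have hsplit : (univ : Finset ι).powerset =
      (univ : Finset ι).powerset.filter (fun S => i ∈ S) ∪ (univ.erase i).powerset := by
    ext S
    simp only [mem_powerset, subset_univ, true_and, mem_union, mem_filter, subset_erase]
    tauto
  have hdisj : Disjoint ((univ : Finset ι).powerset.filter (fun S => i ∈ S))
      (univ.erase i).powerset := by
    rw [Finset.disjoint_left]
    intro S hS hS'
    rw [mem_filter] at hS
    rw [mem_powerset, subset_erase] at hS'
    exact hS'.2 hS.2
  rw [hsplit, sum_union hdisj, hoff] at htot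
  linarith

/-! ### Annihilation by `E_i`, orthogonality -/

/-- `E_{i} E_{Rᶜ} = E_{(R.erase i)ᶜ}`. [folklore] -/
theorem coordAvg_singleton_coordAvg_compl [Nonempty Γ] (i : ι) (R : Finset ι) (F : (ι → Γ) → ℝ) :
    coordAvg {i} (coordAvg Rᶜ F) = coordAvg (R.erase i)ᶜ F := by
  rw [coordAvg_coordAvg]
  congr 1
  ext j
  by_cases h : j = i <;> simp [h]

/-- `E_{i}` kills every component above `i`: `E_{i} F^{=S} = 0` for `i ∈ S` (the terms `R` and
`insert i R` of the inclusion–exclusion cancel). [cite: ODonnell2014, §8.3 Prop. 8.36] -/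
theorem coordAvg_singleton_hoeffdingComp_eq_zero [Nonempty Γ] {i : ι} {S : Finset ι} (hi : i ∈ S)
    (F : (ι → Γ) → ℝ) : coordAvg {i} (hoeffdingComp S F) = fun _ => 0 := by
  funext y
  have hlin : coordAvg {i} (hoeffdingComp S F) y =
      ∑ R ∈ S.powerset, (-1 : ℝ) ^ (S \ R).card * coordAvg (R.erase i)ᶜ F y := by
    have h := coordAvg_sum {i} S.powerset (fun R y' => (-1 : ℝ) ^ (S \ R).card * coordAvg Rᶜ F y')
    simp only [coordAvg_smul, coordAvg_singleton_coordAvg_compl] at h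
    exact congrFun h y
  rw [hlin, ← insert_erase hi, sum_powerset_insert (notMem_erase i S), insert_erase hi]
  rw [← sum_add_distrib]
  refine sum_eq_zero fun R hR => ?_
  have hiR : i ∉ R := fun h => (mem_powerset.1 hR h) |> notMem_erase i S
  have hRS : R ⊆ S := (mem_powerset.1 hR).trans (erase_subset i S)
  rw [erase_insert hiR, erase_eq_of_notMem hiR]
  -- signs: `|S \ R| = |S \ insert i R| + 1`
  have hmem : i ∈ S \ R := mem_sdiff.2 ⟨hi, hiR⟩
  have hcard : (S \ R).card = (S \ insert i R).card + 1 := by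
    rw [sdiff_insert, card_erase_of_mem hmem]
    have : 0 < (S \ R).card := card_pos.2 ⟨i, hmem⟩
    omega
  rw [hcard, pow_succ]
  ring

/-- `E_{i}` fixes every component not above `i`: `E_{i} F^{=S} = F^{=S}` for `i ∉ S`.
[cite: ODonnell2014, §8.3 Prop. 8.36] -/
theorem coordAvg_singleton_hoeffdingComp_eq_self [Nonempty Γ] {i : ι} {S : Finset ι} (hi : i ∉ S)
    (F : (ι → Γ) → ℝ) : coordAvg {i} (hoeffdingComp S F) = hoeffdingComp S F := by
  funext y
  have h := coordAvg_sum {i} S.powerset (fun R y' => (-1 : ℝ) ^ (S \ R).card * coordAvg Rᶜ F y')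
  simp only [coordAvg_smul, coordAvg_singleton_coordAvg_compl] at h
  rw [show hoeffdingComp S F = fun y' => ∑ R ∈ S.powerset, (-1 : ℝ) ^ (S \ R).card * coordAvg Rᶜ F y'
    from rfl, h]
  refine sum_congr rfl fun R hR => ?_
  have hiR : i ∉ R := fun h => hi (mem_powerset.1 hR h)
  rw [erase_eq_of_notMem hiR]

/-- **Orthogonality of the Hoeffding components** (O'Donnell 2014, Thm. 8.35): for `S ≠ S'` and any
two functions `F, G`, `Σ_y F^{=S} y · G^{=S'} y = 0`. Proof: pick `i` in the symmetric difference;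
`E_{i}` is self-adjoint, kills the component containing `i` and fixes the other.
[cite: ODonnell2014, §8.3 Thm. 8.35] -/
theorem sum_hoeffdingComp_mul_hoeffdingComp_eq_zero [Nonempty Γ] {S S' : Finset ι} (hSS' : S ≠ S')
    (F G : (ι → Γ) → ℝ) : ∑ y, hoeffdingComp S F y * hoeffdingComp S' G y = 0 := by
  rcases not_and_or.1 (fun h : S ⊆ S' ∧ S' ⊆ S => hSS' (subset_antisymm h.1 h.2)) with h | h
  · obtain ⟨i, hiS, hiS'⟩ := not_subset.1 h
    calc ∑ y, hoeffdingComp S F y * hoeffdingComp S' G y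
        = ∑ y, hoeffdingComp S F y * coordAvg {i} (hoeffdingComp S' G) y := by
          rw [coordAvg_singleton_hoeffdingComp_eq_self hiS']
      _ = ∑ y, coordAvg {i} (hoeffdingComp S F) y * hoeffdingComp S' G y :=
          (sum_coordAvg_mul {i} _ _).symm
      _ = 0 := by rw [coordAvg_singleton_hoeffdingComp_eq_zero hiS]; simp
  · obtain ⟨i, hiS', hiS⟩ := not_subset.1 h
    calc ∑ y, hoeffdingComp S F y * hoeffdingComp S' G y
        = ∑ y, coordAvg {i} (hoeffdingComp S F) y * hoeffdingComp S' G y := by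
          rw [coordAvg_singleton_hoeffdingComp_eq_self hiS]
      _ = ∑ y, hoeffdingComp S F y * coordAvg {i} (hoeffdingComp S' G) y :=
          sum_coordAvg_mul {i} _ _
      _ = 0 := by rw [coordAvg_singleton_hoeffdingComp_eq_zero hiS']; simp

/-- **Pythagoras / Parseval for the components**: for any family `𝒜` of coordinate sets,
`Σ_y (Σ_{S ∈ 𝒜} F^{=S} y)² = Σ_{S ∈ 𝒜} Σ_y (F^{=S} y)²`. [cite: ODonnell2014, §8.3 Thm. 8.35] -/
theorem sum_sq_sum_hoeffdingComp [Nonempty Γ] (𝒜 : Finset (Finset ι)) (F : (ι → Γ) → ℝ) :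
    ∑ y, (∑ S ∈ 𝒜, hoeffdingComp S F y) ^ 2 = ∑ S ∈ 𝒜, ∑ y, hoeffdingComp S F y ^ 2 := by
  classical
  simp only [sq, sum_mul_sum]
  rw [sum_comm]
  refine sum_congr rfl fun S hS => ?_
  rw [sum_comm]
  rw [← sum_erase_add _ _ hS, sum_eq_zero fun S' hS' => ?_, zero_add]
  exact sum_hoeffdingComp_mul_hoeffdingComp_eq_zero (ne_of_mem_erase hS').symm F F

/-! ### Juntas and degree -/

/-- A junta has no component outside its support: if `F` depends only on the coordinates in `T` and
`S ⊄ T` then `F^{=S} = 0` (for `i ∈ S ∖ T` the terms `R` and `insert i R` cancel, since `E_{i}`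
fixes `F`). [cite: ODonnell2014, §8.3] -/
theorem hoeffdingComp_eq_zero_of_dependsOn [Nonempty Γ] {S T : Finset ι} {F : (ι → Γ) → ℝ}
    (hF : DependsOn F (↑T : Set ι)) (hST : ¬ S ⊆ T) : hoeffdingComp S F = fun _ => 0 := by
  obtain ⟨i, hiS, hiT⟩ := not_subset.1 hST
  have hfix : coordAvg {i} F = F :=
    coordAvg_eq_self_of_dependsOn hF fun j hj => by
      rw [mem_singleton.1 hj]; exact_mod_cast hiT
  -- `E_{(insert i R)ᶜ} F = E_{Rᶜ} F` for `i ∉ R`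
  have hpair : ∀ R : Finset ι, i ∉ R → coordAvg (insert i R)ᶜ F = coordAvg Rᶜ F := by
    intro R hiR
    have h1 : coordAvg Rᶜ F = coordAvg ({i} ∪ (insert i R)ᶜ) F := by
      congr 1; ext j; by_cases h : j = i <;> simp [h, hiR]
    rw [h1, ← coordAvg_coordAvg, coordAvg_comm, hfix]
  funext y
  rw [hoeffdingComp, ← insert_erase hiS, sum_powerset_insert (notMem_erase i S), insert_erase hiS,
    ← sum_add_distrib]
  refine sum_eq_zero fun R hR => ?_
  have hiR : i ∉ R := fun h => (mem_powerset.1 hR h) |> notMem_erase i S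
  have hmem : i ∈ S \ R := mem_sdiff.2 ⟨hiS, hiR⟩
  have hcard : (S \ R).card = (S \ insert i R).card + 1 := by
    rw [sdiff_insert, card_erase_of_mem hmem]
    have : 0 < (S \ R).card := card_pos.2 ⟨i, hmem⟩
    omega
  rw [hpair R hiR, hcard, pow_succ]
  ring

/-- **No components above the degree**: a finite sum of functions each depending on at most `D`
coordinates (coordinate / Efron–Stein degree `≤ D`, the body of
`Literature.Computability.Complexity.IsCoordDegreeLE`) has `F^{=S} = 0` whenever `#S > D`.
[cite: ODonnell2014, §8.3] -/
theorem hoeffdingComp_eq_zero_of_degree [Nonempty Γ] {D : ℕ} {F : (ι → Γ) → ℝ}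
    (hF : ∃ (𝒮 : Finset (Finset ι)) (G : Finset ι → (ι → Γ) → ℝ),
      (∀ T ∈ 𝒮, T.card ≤ D ∧ DependsOn (G T) (↑T : Set ι)) ∧ ∀ y, F y = ∑ T ∈ 𝒮, G T y)
    {S : Finset ι} (hS : D < S.card) : hoeffdingComp S F = fun _ => 0 := by
  obtain ⟨𝒮, G, hG, hFG⟩ := hF
  have hF' : F = fun y => ∑ T ∈ 𝒮, G T y := funext hFG
  rw [hF', hoeffdingComp_sum]
  funext y
  refine sum_eq_zero fun T hT => ?_
  have hST : ¬ S ⊆ T := fun h => (lt_of_le_of_lt ((hG T hT).1) hS).not_ge (card_le_card h)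
  rw [hoeffdingComp_eq_zero_of_dependsOn (hG T hT).2 hST]

/-- **`L²`-influences through the components**: `Σ_y (F y − E_{i} F y)² = Σ_{S ∋ i} Σ_y (F^{=S} y)²`.
[cite: ODonnell2014, §8.3 Prop. 8.45] -/
theorem sum_sq_sub_coordAvg_singleton [Nonempty Γ] (i : ι) (F : (ι → Γ) → ℝ) :
    ∑ y, (F y - coordAvg {i} F y) ^ 2 =
      ∑ S ∈ (univ : Finset ι).powerset.filter (fun S => i ∈ S), ∑ y, hoeffdingComp S F y ^ 2 := by
  rw [← sum_sq_sum_hoeffdingComp]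
  exact sum_congr rfl fun y _ => by rw [sub_coordAvg_singleton_eq_sum]

/-- **Parseval**: `Σ_y F y² = Σ_S Σ_y (F^{=S} y)²`. [cite: ODonnell2014, §8.3 Thm. 8.35] -/
theorem sum_sq_eq_sum_hoeffdingComp_sq [Nonempty Γ] (F : (ι → Γ) → ℝ) :
    ∑ y, F y ^ 2 = ∑ S ∈ (univ : Finset ι).powerset, ∑ y, hoeffdingComp S F y ^ 2 := by
  rw [← sum_sq_sum_hoeffdingComp]
  exact sum_congr rfl fun y _ => by rw [sum_hoeffdingComp_univ]

/-- **Total influence is at most degree times energy** (O'Donnell 2014, §8.3–8.4: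
`I[f] = Σ_S |S|·‖f^{=S}‖² ≤ deg f · ‖f‖²`, counting form on a general finite product space): if
`F` is a finite sum of functions each depending on at most `D` coordinates, then
`Σ_i Σ_y (F y − E_{i} F y)² ≤ D · Σ_y F y²`. [cite: ODonnell2014, §8.4 Prop. 8.45] -/
theorem sum_sum_sq_sub_coordAvg_le [Nonempty Γ] {D : ℕ} {F : (ι → Γ) → ℝ}
    (hF : ∃ (𝒮 : Finset (Finset ι)) (G : Finset ι → (ι → Γ) → ℝ),
      (∀ T ∈ 𝒮, T.card ≤ D ∧ DependsOn (G T) (↑T : Set ι)) ∧ ∀ y, F y = ∑ T ∈ 𝒮, G T y) :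
    ∑ i, ∑ y, (F y - coordAvg {i} F y) ^ 2 ≤ D * ∑ y, F y ^ 2 := by
  -- `Σ_i Σ_{S ∋ i} a_S = Σ_S |S| a_S`
  have hlhs : ∑ i, ∑ y, (F y - coordAvg {i} F y) ^ 2 =
      ∑ S ∈ (univ : Finset ι).powerset, (S.card : ℝ) * ∑ y, hoeffdingComp S F y ^ 2 := by
    simp_rw [sum_sq_sub_coordAvg_singleton, sum_filter]
    rw [sum_comm]
    refine sum_congr rfl fun S _ => ?_
    rw [sum_ite_mem, univ_inter, sum_const, nsmul_eq_mul]
  have hrhs : (D : ℝ) * ∑ y, F y ^ 2 =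
      ∑ S ∈ (univ : Finset ι).powerset, (D : ℝ) * ∑ y, hoeffdingComp S F y ^ 2 := by
    rw [sum_sq_eq_sum_hoeffdingComp_sq, mul_sum]
  rw [hlhs, hrhs]
  refine sum_le_sum fun S _ => ?_
  have ha0 : 0 ≤ ∑ y, hoeffdingComp S F y ^ 2 := sum_nonneg fun y _ => sq_nonneg _
  by_cases hS : S.card ≤ D
  · exact mul_le_mul_of_nonneg_right (by exact_mod_cast hS) ha0
  · have hz : ∑ y, hoeffdingComp S F y ^ 2 = 0 := by
      simp [hoeffdingComp_eq_zero_of_degree hF (not_le.1 hS)]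
    rw [hz, mul_zero, mul_zero]

/-- **Resampling form of the degree bound** (low coordinate degree ⇒ small average sensitivity):
for a finite sum `F` of `D`-juntas on `ι → Γ`,
`Σ_i Σ_y Σ_ℓ (F y − F (y[i ↦ ℓ]))² ≤ 2 D |Γ| · Σ_y F y²` — on average over a uniform point, a
uniform coordinate and a fresh uniform value, resampling one coordinate moves `F` by at most
`2D/|ι|` times its energy in mean square. [cite: ODonnell2014, §8.4 Prop. 8.45] -/
theorem sum_sum_sum_sq_sub_update_le [Nonempty Γ] {D : ℕ} {F : (ι → Γ) → ℝ}
    (hF : ∃ (𝒮 : Finset (Finset ι)) (G : Finset ι → (ι → Γ) → ℝ),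
      (∀ T ∈ 𝒮, T.card ≤ D ∧ DependsOn (G T) (↑T : Set ι)) ∧ ∀ y, F y = ∑ T ∈ 𝒮, G T y) :
    ∑ i : ι, ∑ y : ι → Γ, ∑ ℓ : Γ, (F y - F (Function.update y i ℓ)) ^ 2 ≤
      2 * D * Fintype.card Γ * ∑ y, F y ^ 2 := by
  simp_rw [sum_sum_sq_sub_update_eq]
  rw [← mul_sum]
  have h := sum_sum_sq_sub_coordAvg_le hF
  have hΓ : (0 : ℝ) ≤ 2 * Fintype.card Γ := by positivity
  calc 2 * (Fintype.card Γ : ℝ) * ∑ i, ∑ y, (F y - coordAvg {i} F y) ^ 2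
      ≤ 2 * Fintype.card Γ * (D * ∑ y, F y ^ 2) := mul_le_mul_of_nonneg_left h hΓ
    _ = 2 * D * Fintype.card Γ * ∑ y, F y ^ 2 := by ring

end Literature.Probability.Moments

end
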